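import Literature.MathematicalPhysics.QuantumFieldTheory.Balaban1983to89.B9B8KnitBondGpQLettersAtParsReg335

/-!
# `Balaban1983to89.B9B8KnitLetterXDiffCinvReg335` — T. Bałaban, *Propagators for lattice gauge theories in a background field*, Commun. Math. Phys. **99**
# (1985) 389–434 [Balaban1985BackgroundPropagators], (3.25) p. 395 (`X = Q′G′²Q′*`), Thm 3.2 (3.48) p. 398, (3.95) p. 411 AT PRINT's KNIT LETTER FOR EVERY
# MEMBER OF THE LOCAL CLASS (3.35) p. 396 — cell `lit-balaban`'s junction J-B files 23b ∕ 23c (`B9B8KnitLetterXDiffMajorant`, `B9B8KnitLetterCinvTransfer` §4)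
# WITHOUT [5]'s global (52), the block-diagonal letter `E` carrying the LEVEL WEIGHT `ℓ(a)⁻²` of `B9B8KnitLetterTransferReg335`

statement-level skeleton of published theorems with citation tags; proofs where landed; nothing here is a claim about the Yang–Mills mass gap

THE PRINT.  (3.25) p. 395 («Rf = (I − G′Q′*(Q′G′²Q′*)⁻¹Q′G′)f», `X = Q′G′²Q′*`, `C = X⁻¹`), Thm 3.1 (3.42) p. 397, Thm 3.2 (3.48) p. 398, (3.19) p. 393 (the knit
transporters «(52), (53) in [5]»), (3.35) p. 396 (the local class), (3.90) pp. 409–410, (3.95) p. 411; [4] Prop. 2.2 (2.50)–(2.52) p. 232, Lemma 2.1 (2.60)–(2.61)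
p. 234, (2.66)–(2.67) p. 234, (2.83) p. 237; [5] (44) p. 24, (52)–(53) pp. 26–27.

WHY THIS FILE (cell `pub-ymgap`, node N06, seat `dag-n06-j` gen 36; file 3 of the chain «Thm 3.3's block at `parKnitY` on (3.35)»).  J-B 23b ∕ 23c transfer Thm 3.2's
(3.48) block of `C = (Q′G′²Q′*)⁻¹` from def-Y's letter to the knit letter through the resolvent identity `X_K⁻¹ = X_S⁻¹ + X_K⁻¹(X_S − X_K)X_S⁻¹`, pricing
`η⁴(X_S − X_K)` from the `G′`-difference (23b §1–§2) and the `Q′`-differences (23a) — all under the global (52) with the CONSTANT diagonal `θ_E·𝟙` of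
`η⁻²(Δ′_S − Δ′_K)`.  On (3.35) that diagonal is `θ_E·ℓ(a)⁻²·𝟙` (file 1); THIS FILE re-runs 23b §1–§3 and 23c §4 with the weighted letter: in 23b §1 the weight
of `E` cancels the `ℓ²` of `G′_S` at the same point and the remaining weighted product with `G′_K` carries the trivial transfer of the weight `1` (constant
`C ≥ 1`, the only new binder `hC1`), so `η²(G′_K − G′_S) ≺ A_Kθ_EA_SCc₁·ℓ²·e^{−δ′d}` EXACTLY as under (52); §2–§4 are then 23b ∕ 23c verbatim.

WHAT IS PROVED (sorry-free; 0 `def`).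
* §1 ★ `hasMajorant_conj_GpDiff_w`, ★ `hasMajorant_conj_sqDiff_w` — 23b §1–§2 for the WEIGHTED `E` (any `G ≤ U(N)`, knit legs in `G`; same conclusions).
* §2 ★★★ `hasMajorant_conj_XY_sym_sub_knit_reg335` — `conj b(η⁴(X_S − X_K)) ≺ θ_F·ℓ(a)⁴·e^{−δ″d}` on the block carrier for every member of (3.35) (23b's `θ_F`).
* §3 ★★★ `hasMajorant_conj_XinvY_parKnitY_of_letters_reg335` — Thm 3.2 (3.48) at the knit letter for every member of (3.35):
  `conj b(η⁻⁴X(U; parKnitY)⁻¹) ≺ K·c₁(δ‴,α)(1 − θ_FKC₄c₁c₁(δ‴,α))⁻¹·(ℓ⁴)⁻¹·e^{−(1−α)δ‴d}` (23c §4's conclusion VERBATIM).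
HONEST SCOPE.  Re-reading of landed estimates through file 1 ∕ file 2 and n06-l's local lemmas; the `parSymY`-side data (`A_s`, `K`), the knit-side (3.42)₁
majorant `A_k` and the weighted diagonal are DISPLAYED (suppliers: M5.5 ∕ M5.6 at the member, file 1 §2–§3); helper, count-neutral; N06 NOT discharged; nothing
continuum ∕ OS ∕ mass gap ∕ Clay — the Yang–Mills mass gap is NOT proved here.  No `sorry`, no `axiom`, no `instance`, no `notation`, no `def`.  NEW file.
RELATED, NOT DUPLICATED (searched 2026-08-30: `rg -l -w "XDiffCinvReg335|GpDiff_w|sqDiff_w|of_letters_reg335"` over `lean/Literature` = ∅): the (52) originals J-B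
23b ∕ 23c (USED BY NAME: `hasMajorant_conj_sq`, `smul_XY_sub_eq`, `rate_le`, `hasMajorant_rate_mono`, `hasMajorant_conj_XinvY_parKnitY_of_parSymY`).
-/

noncomputable section

namespace Literature.MathematicalPhysics.QuantumFieldTheory.Balaban1983to89.B9B8KnitLetterXDiffCinvReg335

open Node00 B9Thm311DeltaPrimePos B9Thm311ReadingCoords
open B6Geom246MultiLevelBox (blkOf)
open B6KLevelCensusIndexV1 (KIdx kGeo)
open B6Ineq2142KLevelV1 (β)
open B6RandomWalk (HasMajorant Triangle254 Ineq261 Ineq263 hasMajorant_mono hasMajorant_mul hasMajorant_add c1_nonneg)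
open B6RandomWalkHom (HasMajorantHom)
open B9Thm34Ext (toB6)
open B9GeoNormsKLevelV1 (geo9K)
open B9GeoLemma21KLevelV1 (geo9K_dist_nonneg' geo9K_len_pos)
open B9Ineq347 (ScaleTransfer)
open B9Eq352DivFormLetters (conj conj_mul conj_sub conj_neg)
open B9Eq352GradLetters (conj_add)
open B9Eq376POneLetters (conjHom)
open B9Thm39CinvUpperL (hasMajorant_mul_weighted)
open B9Cor35GpCubeInputsAtOne (hasMajorant_neg)
open B9Thm39CinvSandwichQ (hasMajorant_conj_sandwich hasMajorantHom_conjHom_QpY hasMajorantHom_conjHom_QpsY smul_XY_restrictScalars)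
open B9B8KnitLetterMajorantTransfer (conj_fixedPoint sum_ite_eq_mul geo9K_len_sq_le_one)
open B9B8KnitLetterXDiffMajorant (rate_le hasMajorant_rate_mono hasMajorant_conj_sq sq_sub_sq_eq three_term_eq smul_XY_sub_eq)
open B9B8KnitLetterCinvTransfer (hasMajorant_conj_XinvY_parKnitY_of_parSymY)
open B9B8KnitBondGpQLettersAtParsReg335 (hasMajorantHom_conjHom_QpY_sym_sub_knit_reg335 hasMajorantHom_conjHom_QpsY_sym_sub_knit_reg335)
open B7Prop2Explicit (C0 c2' unitaryUnits)
open B9B8AveragingJunction (parKnitY)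
open B9Eq3124HZKnitPairReg335Y (parKnitY_mem_unitary_of_reg335P)
open B9BackgroundsKLevelV1P (bg9KP mem_of_reg335P)
open B9C2FormBoxRegimeY (Kpl)
open scoped Matrix Matrix.Norms.L2Operator

variable {d ℓ : ℕ} {hd : 1 ≤ d + 1} {hL : Odd (ℓ + 1) ∧ 1 < ℓ + 1} {b₀ b₁ : ℝ}
variable (i : KIdx d ℓ hd hL b₀ b₁) {N : ℕ} {G : Subgroup (Matrix (Fin N) (Fin N) ℂ)ˣ}
variable {ι : Type} [Fintype ι] (b : Module.Basis ι ℝ (Matrix (Fin N) (Fin N) ℂ))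
variable [Fintype (geo9K i).Site] [DecidableEq (geo9K i).Site] {Rr : ℝ} {Hp : Prop} (ιB : BlkY i → IBondY i)

/-! ## §1 23b §1–§2 for the weighted block-diagonal letter -/


/-- ★ **THE LETTER `η²(G′(U; parKnitY) − G′(U; parSymY))` HAS THE MAJORANT `A_kθ_EA_sCc₁·ℓ(a)²·e^{−δ′d}`, WEIGHTED `E`** (file 9's realified resolvent identity
`conj(η²G′_k) − conj(η²G′_s) = conj(η²G′_k)·conj(η⁻²E)·conj(η²G′_s)`; the LEVEL-WEIGHTED diagonal majorant `θ_E·ℓ(a)⁻²·𝟙` of `η⁻²E` (the local class (3.35), file 1)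
cancels the weight `ℓ²` of `G′_s` at its point, then ONE weighted product with `G′_k` (transfer of the weight `1`, constant `C ≥ 1`)) — J-B 23b §1's
`hasMajorant_conj_GpDiff` with the same conclusion.  Displayed: the two (3.42)₁ majorants, the weighted diagonal majorant of `η⁻²E`, the geometry.
[cite: Balaban1985BackgroundPropagators, Thm 3.1 (3.42) p.397, (3.90) pp.409–410, (3.19) p.393; Balaban1984PropagatorsII, (2.50)–(2.52) p.232, (2.60)–(2.61) p.234] -/
theorem hasMajorant_conj_GpDiff_w [Nonempty (Fin N)] (hG : G ≤ unitaryUnits (Matrix (Fin N) (Fin N) ℂ))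
    {U : CfgY (Matrix (Fin N) (Fin N) ℂ) i} (hU : ∀ μ x, U μ x ∈ G) (hparK : ∀ z w : SiteY i, parKnitY i U z w ∈ G)
    (d₁ : ℕ) {δ αst α' C As Ak θE : ℝ} (hAs : 0 ≤ As) (hAk : 0 ≤ Ak) (hθE : 0 ≤ θE) (hC : 0 ≤ C) (hC1 : 1 ≤ C)
    (hαδ : 0 ≤ αst * δ) (hα'0 : 0 ≤ α') (hα'1 : α' ≤ 1) (hδ' : 0 ≤ (1 - αst) * δ)
    (htri : Triangle254 (toB6 (geo9K i) Rr Hp)) (hdnn : ∀ a a' : (geo9K i).Site, 0 ≤ (geo9K i).dist a a')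
    (h261 : Ineq261 d₁ (toB6 (geo9K i) Rr Hp) ((1 - αst) * δ) α')
    (hE : HasMajorant (g := toB6 (geo9K i) Rr Hp) (fun p : SiteY i × ι => ιB (blkOf i.D.toDomains p.1))
      (conj b ((etaS i ^ 2)⁻¹ • (deltaPrimeAY i (parSymY i) U - deltaPrimeAY i (parKnitY i) U).restrictScalars ℝ))
      (fun a a' : (geo9K i).Site => if a = a' then θE * ((geo9K i).len a ^ 2)⁻¹ else 0))
    (hGs : HasMajorant (g := toB6 (geo9K i) Rr Hp) (fun p : SiteY i × ι => ιB (blkOf i.D.toDomains p.1))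
      (conj b ((etaS i ^ 2) • (GpY i (parSymY i) U).restrictScalars ℝ)) (fun a a' => As * (geo9K i).len a ^ 2 * Real.exp (-(δ * (geo9K i).dist a a'))))
    (hGk : HasMajorant (g := toB6 (geo9K i) Rr Hp) (fun p : SiteY i × ι => ιB (blkOf i.D.toDomains p.1))
      (conj b ((etaS i ^ 2) • (GpY i (parKnitY i) U).restrictScalars ℝ)) (fun a a' => Ak * (geo9K i).len a ^ 2 * Real.exp (-(δ * (geo9K i).dist a a')))) :
    HasMajorant (g := toB6 (geo9K i) Rr Hp) (fun p : SiteY i × ι => ιB (blkOf i.D.toDomains p.1))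
      (conj b ((etaS i ^ 2) • ((GpY i (parKnitY i) U).restrictScalars ℝ - (GpY i (parSymY i) U).restrictScalars ℝ)))
      (fun a a' => Ak * (θE * As) * C * B6.c1 d₁ ((1 - αst) * δ) α' * (geo9K i).len a ^ 2 *
        Real.exp (-((1 - α') * ((1 - αst) * δ) * (geo9K i).dist a a'))) := by
  have hl : ∀ a : (geo9K i).Site, 0 ≤ (geo9K i).len a ^ 2 := fun a => sq_nonneg _
  -- the remainder `R′ = conj(η⁻²E)·conj(η²G′_s) ≺ θ_E·A_s·e^{−δd}`, WEIGHT-FREE: the level weight of `E` cancels the `ℓ²` of `G′_s` at the same point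
  have hK₂ : ∀ a a' : (geo9K i).Site, 0 ≤ As * (geo9K i).len a ^ 2 * Real.exp (-(δ * (geo9K i).dist a a')) := fun a a' =>
    mul_nonneg (mul_nonneg hAs (hl a)) (Real.exp_nonneg _)
  have hR : HasMajorant (g := toB6 (geo9K i) Rr Hp) (fun p : SiteY i × ι => ιB (blkOf i.D.toDomains p.1))
      (conj b ((etaS i ^ 2)⁻¹ • (deltaPrimeAY i (parSymY i) U - deltaPrimeAY i (parKnitY i) U).restrictScalars ℝ)
        * conj b ((etaS i ^ 2) • (GpY i (parSymY i) U).restrictScalars ℝ))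
      (fun a a' => (θE * As) * (1 : ℝ) * Real.exp (-(δ * (geo9K i).dist a a'))) := by
    refine hasMajorant_mono _ (hasMajorant_mul _ hE hGs hK₂) fun a a' => ?_
    have hsum := sum_ite_eq_mul (S := (geo9K i).Site) a (θE * ((geo9K i).len a ^ 2)⁻¹)
      (fun y'' => As * (geo9K i).len y'' ^ 2 * Real.exp (-(δ * (geo9K i).dist y'' a')))
    refine (le_of_eq hsum).trans (le_of_eq ?_)
    have hla : (geo9K i).len a ^ 2 ≠ 0 := pow_ne_zero 2 (geo9K_len_pos i a).ne'
    calc θE * ((geo9K i).len a ^ 2)⁻¹ * (As * (geo9K i).len a ^ 2 * Real.exp (-(δ * (geo9K i).dist a a')))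
        = θE * As * (((geo9K i).len a ^ 2)⁻¹ * (geo9K i).len a ^ 2) * Real.exp (-(δ * (geo9K i).dist a a')) := by ring
      _ = θE * As * (1 : ℝ) * Real.exp (-(δ * (geo9K i).dist a a')) := by rw [inv_mul_cancel₀ hla]
  -- the trivial scale transfer of the weight `1` (constant `C ≥ 1`)
  have hST1 : ScaleTransfer (geo9K i) δ αst C (fun _ : (geo9K i).Site => (1 : ℝ)) := fun a a' => by
    have h1 : Real.exp (-(αst * δ * (geo9K i).dist a a')) ≤ 1 := Real.exp_le_one_iff.2 (by nlinarith [hdnn a a', hαδ])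
    linarith
  -- ONE weighted product with `conj(η²G′_k)` on the left: weights `ℓ²·1`, rate `δ′`
  have hprod := hasMajorant_mul_weighted (g := geo9K i) (R := Rr) (H := Hp) (fun p : SiteY i × ι => ιB (blkOf i.D.toDomains p.1)) d₁
    (fun a => (geo9K i).len a ^ 2) (fun _ => (1 : ℝ)) hAk (mul_nonneg hθE hAs) hC hl (fun _ => zero_le_one) hαδ hα'0 hα'1 hδ' htri hdnn hST1 h261
    hGk hR
  -- the operator IS `conj(η²(G′_k − G′_s))` by file 9's fixed-point identity
  have hfix := conj_fixedPoint i b hG hU hparK (B9Ineq349SiteComposite.etaS_pos i).ne'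
  have hop : conj b ((etaS i ^ 2) • ((GpY i (parKnitY i) U).restrictScalars ℝ - (GpY i (parSymY i) U).restrictScalars ℝ)) =
      conj b ((etaS i ^ 2) • (GpY i (parKnitY i) U).restrictScalars ℝ) *
        (conj b ((etaS i ^ 2)⁻¹ • (deltaPrimeAY i (parSymY i) U - deltaPrimeAY i (parKnitY i) U).restrictScalars ℝ)
          * conj b ((etaS i ^ 2) • (GpY i (parSymY i) U).restrictScalars ℝ)) := by
    rw [smul_sub, conj_sub]
    exact sub_eq_of_eq_add' hfix
  rw [hop, ← mul_assoc]
  refine hasMajorant_mono _ (by rw [mul_assoc]; exact hprod) fun a a' => le_of_eq ?_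
  ring


/-- ★ **THE DIFFERENCE OF THE SQUARES (WEIGHTED `E`, J-B 23b §2's `hasMajorant_conj_sqDiff` with the same conclusion) `η⁴(G′_s² − G′_k²) ≺ (A_s + A_k)·θ_D·L²c₁′·ℓ⁴·e^{−δ″d}`**, `θ_D = A_kθ_EA_sL²c₁` (§1), `δ″ = (1−α′)(1−α_st)δ′`: from
`a² − c² = −(a(c − a) + (c − a)c)`, §1 for `c − a` (rate `δ′`, weight `ℓ²`), the two (3.42)₁ majorants weakened to the rate `δ′`, and two weighted products at
the second rate level (scale transfer of `ℓ²` and (2.61) at `δ′`). [cite: Balaban1985BackgroundPropagators, (3.95) p.411, (3.90) pp.409–410; Balaban1984PropagatorsII, (2.83) p.237, (2.50)–(2.52) p.232, (2.60)–(2.61) p.234] -/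
theorem hasMajorant_conj_sqDiff_w [Nonempty (Fin N)] (hG : G ≤ unitaryUnits (Matrix (Fin N) (Fin N) ℂ))
    {U : CfgY (Matrix (Fin N) (Fin N) ℂ) i} (hU : ∀ μ x, U μ x ∈ G) (hparK : ∀ z w : SiteY i, parKnitY i U z w ∈ G)
    (d₁ d₂ : ℕ) {δ αst α' C As Ak θE : ℝ} (hAs : 0 ≤ As) (hAk : 0 ≤ Ak) (hθE : 0 ≤ θE) (hC : 0 ≤ C) (hC1 : 1 ≤ C)
    (hαδ : 0 ≤ αst * δ) (hα'0 : 0 ≤ α') (hα'1 : α' ≤ 1) (hδ' : 0 ≤ (1 - αst) * δ)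
    (hαδ₂ : 0 ≤ αst * ((1 - α') * ((1 - αst) * δ))) (hδ'₂ : 0 ≤ (1 - αst) * ((1 - α') * ((1 - αst) * δ)))
    (htri : Triangle254 (toB6 (geo9K i) Rr Hp)) (hdnn : ∀ a a' : (geo9K i).Site, 0 ≤ (geo9K i).dist a a')
    (h261 : Ineq261 d₁ (toB6 (geo9K i) Rr Hp) ((1 - αst) * δ) α')
    (hST₂ : ScaleTransfer (geo9K i) ((1 - α') * ((1 - αst) * δ)) αst C (fun a => (geo9K i).len a ^ 2))
    (h261₂ : Ineq261 d₂ (toB6 (geo9K i) Rr Hp) ((1 - αst) * ((1 - α') * ((1 - αst) * δ))) α')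
    (hE : HasMajorant (g := toB6 (geo9K i) Rr Hp) (fun p : SiteY i × ι => ιB (blkOf i.D.toDomains p.1))
      (conj b ((etaS i ^ 2)⁻¹ • (deltaPrimeAY i (parSymY i) U - deltaPrimeAY i (parKnitY i) U).restrictScalars ℝ))
      (fun a a' : (geo9K i).Site => if a = a' then θE * ((geo9K i).len a ^ 2)⁻¹ else 0))
    (hGs : HasMajorant (g := toB6 (geo9K i) Rr Hp) (fun p : SiteY i × ι => ιB (blkOf i.D.toDomains p.1))
      (conj b ((etaS i ^ 2) • (GpY i (parSymY i) U).restrictScalars ℝ)) (fun a a' => As * (geo9K i).len a ^ 2 * Real.exp (-(δ * (geo9K i).dist a a'))))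
    (hGk : HasMajorant (g := toB6 (geo9K i) Rr Hp) (fun p : SiteY i × ι => ιB (blkOf i.D.toDomains p.1))
      (conj b ((etaS i ^ 2) • (GpY i (parKnitY i) U).restrictScalars ℝ)) (fun a a' => Ak * (geo9K i).len a ^ 2 * Real.exp (-(δ * (geo9K i).dist a a')))) :
    HasMajorant (g := toB6 (geo9K i) Rr Hp) (fun p : SiteY i × ι => ιB (blkOf i.D.toDomains p.1))
      (conj b ((etaS i ^ 2 * etaS i ^ 2) • ((GpY i (parSymY i) U).restrictScalars ℝ * (GpY i (parSymY i) U).restrictScalars ℝ -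
        (GpY i (parKnitY i) U).restrictScalars ℝ * (GpY i (parKnitY i) U).restrictScalars ℝ)))
      (fun a a' => (As + Ak) * (Ak * (θE * As) * C * B6.c1 d₁ ((1 - αst) * δ) α') * C * B6.c1 d₂ ((1 - αst) * ((1 - α') * ((1 - αst) * δ))) α' *
        ((geo9K i).len a ^ 2 * (geo9K i).len a ^ 2) *
        Real.exp (-((1 - α') * ((1 - αst) * ((1 - α') * ((1 - αst) * δ))) * (geo9K i).dist a a'))) := by
  set Gs : Module.End ℝ (SiteY i → Matrix (Fin N) (Fin N) ℂ) := (GpY i (parSymY i) U).restrictScalars ℝ with hGs_def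
  set Gk : Module.End ℝ (SiteY i → Matrix (Fin N) (Fin N) ℂ) := (GpY i (parKnitY i) U).restrictScalars ℝ with hGk_def
  set δ' : ℝ := (1 - α') * ((1 - αst) * δ) with hδ'def
  set θD : ℝ := Ak * (θE * As) * C * B6.c1 d₁ ((1 - αst) * δ) α' with hθDdef
  have hl : ∀ a : (geo9K i).Site, 0 ≤ (geo9K i).len a ^ 2 := fun a => sq_nonneg _
  have hθD : 0 ≤ θD := mul_nonneg (mul_nonneg (mul_nonneg hAk (mul_nonneg hθE hAs)) hC) (c1_nonneg _ _ _)
  have hle : δ' ≤ δ := rate_le hαδ hα'0 hδ'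
  -- §1: the difference letter at rate `δ′`, weight `ℓ²`
  have hD := hasMajorant_conj_GpDiff_w i b ιB (Rr := Rr) (Hp := Hp) hG hU hparK d₁ hAs hAk hθE hC hC1 hαδ hα'0 hα'1 hδ' htri hdnn h261 hE hGs hGk
  -- the two (3.42)₁ majorants at the rate `δ′`
  have hGs' := hasMajorant_rate_mono i (Rr := Rr) (Hp := Hp) (fun p : SiteY i × ι => ιB (blkOf i.D.toDomains p.1)) (fun a => (geo9K i).len a ^ 2) hAs hl hle hGs
  have hGk' := hasMajorant_rate_mono i (Rr := Rr) (Hp := Hp) (fun p : SiteY i × ι => ιB (blkOf i.D.toDomains p.1)) (fun a => (geo9K i).len a ^ 2) hAk hl hle hGk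
  -- the two products `a·(c − a)` and `(c − a)·c` at the second rate level
  have h1 := B9Thm39CinvUpperL.hasMajorant_conj_mul_weighted b (g := geo9K i) (R := Rr) (H := Hp) (fun p : SiteY i × ι => ιB (blkOf i.D.toDomains p.1)) d₂
    (fun a => (geo9K i).len a ^ 2) (fun a => (geo9K i).len a ^ 2) (etaS i ^ 2) (etaS i ^ 2) hAs hθD hC hl hl hαδ₂ hα'0 hα'1 hδ'₂ htri hdnn hST₂ h261₂
    hGs' hD
  have h2 := B9Thm39CinvUpperL.hasMajorant_conj_mul_weighted b (g := geo9K i) (R := Rr) (H := Hp) (fun p : SiteY i × ι => ιB (blkOf i.D.toDomains p.1)) d₂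
    (fun a => (geo9K i).len a ^ 2) (fun a => (geo9K i).len a ^ 2) (etaS i ^ 2) (etaS i ^ 2) hθD hAk hC hl hl hαδ₂ hα'0 hα'1 hδ'₂ htri hdnn hST₂ h261₂
    hD hGk'
  -- the identity `η⁴(a² − c²) = −(η⁴·a(c−a) + η⁴·(c−a)c)` under `conj`
  have hop : conj b ((etaS i ^ 2 * etaS i ^ 2) • (Gs * Gs - Gk * Gk)) =
      -(conj b ((etaS i ^ 2 * etaS i ^ 2) • (Gs * (Gk - Gs))) + conj b ((etaS i ^ 2 * etaS i ^ 2) • ((Gk - Gs) * Gk))) := by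
    rw [sq_sub_sq_eq, smul_neg, conj_neg, smul_add, conj_add]
  rw [hop]
  refine hasMajorant_mono _ (hasMajorant_neg _ (hasMajorant_add _ h1 h2)) fun a a' => le_of_eq ?_
  simp only [hθDdef, hδ'def]
  ring


/-! ## §2 ★★★ The letter `η⁴(X_sym − X_knit)` on the block carrier, on (3.35) -/


/-- ★★★ **`η⁴·(X(U; parSymY) − X(U; parKnitY)) ≺ θ_F·ℓ(a)⁴·e^{−δ″d}` ON def-Y's BLOCK CARRIER FOR EVERY MEMBER OF THE LOCAL CLASS (3.35)** (J-B 23b §3 with (52) replaced by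
`U ∈ (bg9KP … G i).Reg335 c₀ α₀`, `G ≤ U(N)`, and the knit numerics `0 < α₀′`, `C₀α₀′ ≤ ⅓`, `2α₀′ ≤ c₂′`, `K_pl(Mα₀)L⁴ < α₀′`; SAME conclusion), `X = Q′G′²Q′*`, print's units `c_f = L^k`, a real basis `b` with coordinate bound `M₂`, the
geometry at two rate levels, the diagonal majorant `θ_E·𝟙` of `η⁻²(Δ′_sym − Δ′_knit)` (file 9 §1) and the (3.42)₁ majorants `A_s·ℓ²·e^{−δd}`, `A_k·ℓ²·e^{−δd}` of `η²G′`
at the two letters: with `κ = M₂Σ_j‖b_j‖`, `κ_Δ = 2·8(d+1)²α₀′·κ`, `c₁ = c₁(d₁,(1−α_st)δ,α′)`, `c₁′ = c₁(d₂,(1−α_st)δ′,α′)`, `θ_D = A_kθ_EA_sL²c₁`,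
`θ_F := κ_Δκ·A_s²L²c₁ + κκ·(A_s+A_k)θ_DL²c₁′ + κκ_Δ·A_k²L²c₁` (`L² = C`, the scale-transfer constant) and `δ″ = (1−α′)(1−α_st)(1−α′)(1−α_st)δ`:
`conj b(η⁴·(X_s − X_k)) ≺ θ_F·ℓ(a)⁴·e^{−δ″d(a,a′)}` on `(s, j) ↦ ιB s`.
[cite: Balaban1985BackgroundPropagators, (3.25) p.395, (3.95) p.411, Thm 3.1 (3.42) p.397, (3.19) p.393, (3.21)∕(3.24) p.394; Balaban1984PropagatorsII, (2.83) p.237, (2.50)–(2.52) p.232, (2.60)–(2.61) p.234; Balaban1985Averaging, (52)–(53) pp.26–27] -/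
theorem hasMajorant_conj_XY_sym_sub_knit_reg335 [Nonempty (Fin N)]
    (hG1 : ∀ u : (Matrix (Fin N) (Fin N) ℂ)ˣ, u ∈ G → ‖(u : Matrix (Fin N) (Fin N) ℂ)‖ ≤ 1) (hGU : G ≤ unitaryUnits (Matrix (Fin N) (Fin N) ℂ))
    {U : CfgY (Matrix (Fin N) (Fin N) ℂ) i} {c₀ α₀ : ℝ} (hc : c₀ ≤ 10) (hMα : 0 ≤ (kGeo i).M * α₀)
    (hreg : (bg9KP (Matrix (Fin N) (Fin N) ℂ) G i).Reg335 c₀ α₀ U) {α₀' : ℝ} (hα' : 0 < α₀') (hα3 : C0 (d + 1) * α₀' ≤ 1 / 3)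
    (hα2 : 2 * α₀' ≤ c2' (d + 1) (ℓ + 1)) (hK : Kpl i ((kGeo i).M * α₀) * (kGeo i).L ^ 4 < α₀')
    {M₂ : ℝ} (hM₂ : 0 ≤ M₂) (hrepr : ∀ (v : Matrix (Fin N) (Fin N) ℂ) (j : ι), |b.repr v j| ≤ M₂ * ‖v‖)
    (d₁ d₂ : ℕ) {δ αst α' C As Ak θE : ℝ} (hAs : 0 ≤ As) (hAk : 0 ≤ Ak) (hθE : 0 ≤ θE) (hC : 0 ≤ C) (hC1 : 1 ≤ C)
    (hαδ : 0 ≤ αst * δ) (hα'0 : 0 ≤ α') (hα'1 : α' ≤ 1) (hδ' : 0 ≤ (1 - αst) * δ)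
    (hαδ₂ : 0 ≤ αst * ((1 - α') * ((1 - αst) * δ))) (hδ'₂ : 0 ≤ (1 - αst) * ((1 - α') * ((1 - αst) * δ)))
    (htri : Triangle254 (toB6 (geo9K i) Rr Hp)) (hdnn : ∀ a a' : (geo9K i).Site, 0 ≤ (geo9K i).dist a a')
    (hST : ScaleTransfer (geo9K i) δ αst C (fun a => (geo9K i).len a ^ 2))
    (h261 : Ineq261 d₁ (toB6 (geo9K i) Rr Hp) ((1 - αst) * δ) α')
    (hST₂ : ScaleTransfer (geo9K i) ((1 - α') * ((1 - αst) * δ)) αst C (fun a => (geo9K i).len a ^ 2))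
    (h261₂ : Ineq261 d₂ (toB6 (geo9K i) Rr Hp) ((1 - αst) * ((1 - α') * ((1 - αst) * δ))) α')
    (hE : HasMajorant (g := toB6 (geo9K i) Rr Hp) (fun p : SiteY i × ι => ιB (blkOf i.D.toDomains p.1))
      (conj b ((etaS i ^ 2)⁻¹ • (deltaPrimeAY i (parSymY i) U - deltaPrimeAY i (parKnitY i) U).restrictScalars ℝ))
      (fun a a' : (geo9K i).Site => if a = a' then θE * ((geo9K i).len a ^ 2)⁻¹ else 0))
    (hGs : HasMajorant (g := toB6 (geo9K i) Rr Hp) (fun p : SiteY i × ι => ιB (blkOf i.D.toDomains p.1))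
      (conj b ((etaS i ^ 2) • (GpY i (parSymY i) U).restrictScalars ℝ)) (fun a a' => As * (geo9K i).len a ^ 2 * Real.exp (-(δ * (geo9K i).dist a a'))))
    (hGk : HasMajorant (g := toB6 (geo9K i) Rr Hp) (fun p : SiteY i × ι => ιB (blkOf i.D.toDomains p.1))
      (conj b ((etaS i ^ 2) • (GpY i (parKnitY i) U).restrictScalars ℝ)) (fun a a' => Ak * (geo9K i).len a ^ 2 * Real.exp (-(δ * (geo9K i).dist a a')))) :
    HasMajorant (g := toB6 (geo9K i) Rr Hp) (fun q : BlkY i × ι => ιB q.1)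
      (conj b ((etaS i ^ 2 * etaS i ^ 2) • ((XY i (parSymY i) (GpY i (parSymY i)) U).restrictScalars ℝ -
        (XY i (parKnitY i) (GpY i (parKnitY i)) U).restrictScalars ℝ)))
      (fun a a' =>
        ((2 * (8 * ((d : ℝ) + 1) ^ 2 * α₀') * (M₂ * ∑ j, ‖b j‖)) * (M₂ * ∑ j, ‖b j‖) * (As * As * C * B6.c1 d₁ ((1 - αst) * δ) α') +
          (M₂ * ∑ j, ‖b j‖) * (M₂ * ∑ j, ‖b j‖) *
            ((As + Ak) * (Ak * (θE * As) * C * B6.c1 d₁ ((1 - αst) * δ) α') * C * B6.c1 d₂ ((1 - αst) * ((1 - α') * ((1 - αst) * δ))) α') +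
          (M₂ * ∑ j, ‖b j‖) * ((2 * (8 * ((d : ℝ) + 1) ^ 2 * α₀') * (M₂ * ∑ j, ‖b j‖))) * (Ak * Ak * C * B6.c1 d₁ ((1 - αst) * δ) α')) *
        (geo9K i).len a ^ 4 *
        Real.exp (-((1 - α') * ((1 - αst) * ((1 - α') * ((1 - αst) * δ))) * (geo9K i).dist a a'))) := by
  have hU : ∀ μ x, U μ x ∈ G := fun μ x => mem_of_reg335P (G := G) i hreg μ x
  have hUu : ∀ μ x, U μ x ∈ unitaryUnits (Matrix (Fin N) (Fin N) ℂ) := fun μ x => hGU (hU μ x)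
  have hparK : ∀ z w : SiteY i, parKnitY i U z w ∈ unitaryUnits (Matrix (Fin N) (Fin N) ℂ) :=
    fun z w => parKnitY_mem_unitary_of_reg335P i hG1 hGU U hc hMα hreg hα' hα3 hα2 hK z w
  have hparS : ∀ z w : SiteY i, ‖(parSymY i U z w : Matrix (Fin N) (Fin N) ℂ)‖ ≤ 1 ∧
      ‖(((parSymY i U z w)⁻¹ : (Matrix (Fin N) (Fin N) ℂ)ˣ) : Matrix (Fin N) (Fin N) ℂ)‖ ≤ 1 := fun z w => by
    letI : CStarAlgebra (Matrix (Fin N) (Fin N) ℂ) := {}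
    exact B7Prop1Explicit.mem_U1.1 (B7Prop2Explicit.unitaryUnits_le_U1 (hGU (parSymY_mem i hU z w)))
  have hparKc : ∀ z w : SiteY i, ‖(parKnitY i U z w : Matrix (Fin N) (Fin N) ℂ)‖ ≤ 1 ∧
      ‖(((parKnitY i U z w)⁻¹ : (Matrix (Fin N) (Fin N) ℂ)ˣ) : Matrix (Fin N) (Fin N) ℂ)‖ ≤ 1 := fun z w => by
    letI : CStarAlgebra (Matrix (Fin N) (Fin N) ℂ) := {}
    exact B7Prop1Explicit.mem_U1.1 (B7Prop2Explicit.unitaryUnits_le_U1 (hparK z w))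
  -- the three-term identity
  rw [smul_XY_sub_eq]
  set Gs : Module.End ℝ (SiteY i → Matrix (Fin N) (Fin N) ℂ) := (GpY i (parSymY i) U).restrictScalars ℝ with hGs_def
  set Gk : Module.End ℝ (SiteY i → Matrix (Fin N) (Fin N) ℂ) := (GpY i (parKnitY i) U).restrictScalars ℝ with hGk_def
  set δ' : ℝ := (1 - α') * ((1 - αst) * δ) with hδ'def
  set δ'' : ℝ := (1 - α') * ((1 - αst) * δ') with hδ''def
  set κ : ℝ := M₂ * ∑ j, ‖b j‖ with hκdef
  set κΔ : ℝ := 2 * (8 * ((d : ℝ) + 1) ^ 2 * α₀') * (M₂ * ∑ j, ‖b j‖) with hκΔdef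
  set K₁ : ℝ := As * As * C * B6.c1 d₁ ((1 - αst) * δ) α' with hK₁def
  set K₂ : ℝ := (As + Ak) * (Ak * (θE * As) * C * B6.c1 d₁ ((1 - αst) * δ) α') * C * B6.c1 d₂ ((1 - αst) * δ') α' with hK₂def
  set K₃ : ℝ := Ak * Ak * C * B6.c1 d₁ ((1 - αst) * δ) α' with hK₃def
  have hSb : 0 ≤ ∑ j, ‖b j‖ := Finset.sum_nonneg fun _ _ => norm_nonneg _
  have hκ : 0 ≤ κ := mul_nonneg hM₂ hSb
  have hκΔ : 0 ≤ κΔ := by positivity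
  have hc₁ := c1_nonneg d₁ ((1 - αst) * δ) α'
  have hc₂ := c1_nonneg d₂ ((1 - αst) * δ') α'
  have hK₁ : 0 ≤ K₁ := by positivity
  have hK₂ : 0 ≤ K₂ := by positivity
  have hK₃ : 0 ≤ K₃ := by positivity
  have hl4 : ∀ a : (geo9K i).Site, 0 ≤ (geo9K i).len a ^ 2 * (geo9K i).len a ^ 2 := fun a => mul_nonneg (sq_nonneg _) (sq_nonneg _)
  have hle' : δ'' ≤ δ' := rate_le hαδ₂ hα'0 hδ'₂
  -- the three middle letters at the rate `δ″`
  have hT₁ : HasMajorant (g := toB6 (geo9K i) Rr Hp) (fun p : SiteY i × ι => ιB (blkOf i.D.toDomains p.1))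
      (conj b ((etaS i ^ 2 * etaS i ^ 2) • (Gs * Gs))) (fun a a' => K₁ * ((geo9K i).len a ^ 2 * (geo9K i).len a ^ 2) * Real.exp (-(δ'' * (geo9K i).dist a a'))) :=
    hasMajorant_rate_mono i (Rr := Rr) (Hp := Hp) _ (fun a => (geo9K i).len a ^ 2 * (geo9K i).len a ^ 2) hK₁ hl4 hle'
      (hasMajorant_conj_sq i b ιB Gs d₁ hAs hC hαδ hα'0 hα'1 hδ' htri hdnn hST h261 hGs)
  have hT₃ : HasMajorant (g := toB6 (geo9K i) Rr Hp) (fun p : SiteY i × ι => ιB (blkOf i.D.toDomains p.1))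
      (conj b ((etaS i ^ 2 * etaS i ^ 2) • (Gk * Gk))) (fun a a' => K₃ * ((geo9K i).len a ^ 2 * (geo9K i).len a ^ 2) * Real.exp (-(δ'' * (geo9K i).dist a a'))) :=
    hasMajorant_rate_mono i (Rr := Rr) (Hp := Hp) _ (fun a => (geo9K i).len a ^ 2 * (geo9K i).len a ^ 2) hK₃ hl4 hle'
      (hasMajorant_conj_sq i b ιB Gk d₁ hAk hC hαδ hα'0 hα'1 hδ' htri hdnn hST h261 hGk)
  have hT₂ : HasMajorant (g := toB6 (geo9K i) Rr Hp) (fun p : SiteY i × ι => ιB (blkOf i.D.toDomains p.1))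
      (conj b ((etaS i ^ 2 * etaS i ^ 2) • (Gs * Gs) - (etaS i ^ 2 * etaS i ^ 2) • (Gk * Gk)))
      (fun a a' => K₂ * ((geo9K i).len a ^ 2 * (geo9K i).len a ^ 2) * Real.exp (-(δ'' * (geo9K i).dist a a'))) := by
    have h := hasMajorant_conj_sqDiff_w i b ιB (Rr := Rr) (Hp := Hp) le_rfl hUu hparK d₁ d₂ hAs hAk hθE hC hC1 hαδ hα'0 hα'1 hδ' hαδ₂ hδ'₂ htri hdnn
      h261 hST₂ h261₂ hE hGs hGk
    rw [smul_sub] at h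
    exact h
  -- nonnegativity of the three middle kernels
  have hk₁ : ∀ a a' : (geo9K i).Site, 0 ≤ K₁ * ((geo9K i).len a ^ 2 * (geo9K i).len a ^ 2) * Real.exp (-(δ'' * (geo9K i).dist a a')) := fun a a' =>
    mul_nonneg (mul_nonneg hK₁ (hl4 a)) (Real.exp_nonneg _)
  have hk₂ : ∀ a a' : (geo9K i).Site, 0 ≤ K₂ * ((geo9K i).len a ^ 2 * (geo9K i).len a ^ 2) * Real.exp (-(δ'' * (geo9K i).dist a a')) := fun a a' =>
    mul_nonneg (mul_nonneg hK₂ (hl4 a)) (Real.exp_nonneg _)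
  have hk₃ : ∀ a a' : (geo9K i).Site, 0 ≤ K₃ * ((geo9K i).len a ^ 2 * (geo9K i).len a ^ 2) * Real.exp (-(δ'' * (geo9K i).dist a a')) := fun a a' =>
    mul_nonneg (mul_nonneg hK₃ (hl4 a)) (Real.exp_nonneg _)
  -- the three sandwiches
  have hS₁ := hasMajorant_conj_sandwich i b ιB (Rr := Rr) (Hp := Hp) hκ hk₁
    (hasMajorantHom_conjHom_QpY_sym_sub_knit_reg335 i b ιB hG1 hGU hc hMα hreg hα' hα3 hα2 hK hM₂ hrepr)
    (hasMajorantHom_conjHom_QpsY i b ιB (parSymY i) U hparS hM₂ hrepr) hT₁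
  have hS₂ := hasMajorant_conj_sandwich i b ιB (Rr := Rr) (Hp := Hp) hκ hk₂
    (hasMajorantHom_conjHom_QpY i b ιB (parKnitY i) U hparKc hM₂ hrepr)
    (hasMajorantHom_conjHom_QpsY i b ιB (parSymY i) U hparS hM₂ hrepr) hT₂
  have hS₃ := hasMajorant_conj_sandwich i b ιB (Rr := Rr) (Hp := Hp) hκΔ hk₃
    (hasMajorantHom_conjHom_QpY i b ιB (parKnitY i) U hparKc hM₂ hrepr)
    (hasMajorantHom_conjHom_QpsY_sym_sub_knit_reg335 i b ιB hG1 hGU hc hMα hreg hα' hα3 hα2 hK hM₂ hrepr) hT₃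
  -- the sum of the three sandwiches
  rw [conj_add, conj_add]
  refine hasMajorant_mono _ (hasMajorant_add _ (hasMajorant_add _ hS₁ hS₂) hS₃) fun a a' => le_of_eq ?_
  have h4 : (geo9K i).len a ^ 2 * (geo9K i).len a ^ 2 = (geo9K i).len a ^ 4 := by ring
  simp only [hκdef, hκΔdef, hK₁def, hK₂def, hK₃def, hδ''def, hδ'def, h4]
  ring


/-! ## §3 ★★★ (3.48) at the knit letter on (3.35) -/

section Cinv

variable [DecidableEq ι]

/-- ★★★ **[B9] THM 3.2 (3.48) AT THE KNIT LETTER FROM THE LETTERS OF RECORD, FOR EVERY MEMBER OF THE LOCAL CLASS (3.35)** — J-B 23c §4 with `hF` from §3 and (52)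
replaced by `U ∈ (bg9KP … G i).Reg335 c₀ α₀` + the knit numerics (`0 < α₀′`, `C₀α₀′ ≤ ⅓`, `2α₀′ ≤ c₂′`, `K_pl(Mα₀)L⁴ < α₀′`); SAME conclusion; print's units `c_f = L^k`, a
real basis `b` with coordinate bound `M₂`; DISPLAYED at ONE rate `δ`: the (3.42)₁ site majorants `A_s·ℓ²·e^{−δd}`, `A_k·ℓ²·e^{−δd}` of `η²G′` at the two letters
(FILE 9 ∕ M5.5, file 9), the diagonal majorant `θ_E·𝟙` of `η⁻²(Δ′_sym − Δ′_knit)` (file 9 §1), FILE 10's (3.48) majorant `K·ℓ⁻⁴·e^{−δd}` of `η⁻⁴X_sym⁻¹`; the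
geometry ((2.54), `d(y,y)=0`, `d ≥ 0`, scale transfers of `ℓ²` at `δ`, `δ′` (constant `C`) and of `ℓ⁻⁴` at `δ″` (constant `C₄`), (2.61) at `((1−α_st)δ, α′)`,
`((1−α_st)δ′, α′)`, `((1−α_st)δ″, α′)`, (2.61)∕(2.63) at `(δ‴, α)`; `δ′ = (1−α′)(1−α_st)δ`, `δ″ = (1−α′)(1−α_st)δ′`, `δ‴ = (1−α′)(1−α_st)δ″`) and the
smallness `θ_F·K·C₄·c₁((1−α_st)δ″,α′)·c₁(δ‴,α) < 1` with file 23b's `θ_F`.  THEN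
`conj b(η⁻⁴X(U; parKnitY)⁻¹) ≺ K·c₁(δ‴,α)·(1 − θ_FKC₄c₁c₁(δ‴,α))⁻¹·(ℓ(a)⁴)⁻¹·e^{−(1−α)δ‴d}` on `(s, j) ↦ ιB s`.
[cite: Balaban1985BackgroundPropagators, Thm 3.2 (3.48) p.398, Thm 3.1 (3.42) p.397, (3.19) p.393, (3.25) p.395, (3.90) pp.409–410, (3.95) p.411; Balaban1984PropagatorsII, (2.50)–(2.52) p.232, (2.60)–(2.61) p.234, (2.66)–(2.67) p.234, (2.83) p.237; Balaban1985Averaging, (52)–(53) pp.26–27] -/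
theorem hasMajorant_conj_XinvY_parKnitY_of_letters_reg335 [Nonempty (Fin N)]
    (hG1 : ∀ u : (Matrix (Fin N) (Fin N) ℂ)ˣ, u ∈ G → ‖(u : Matrix (Fin N) (Fin N) ℂ)‖ ≤ 1) (hGU : G ≤ unitaryUnits (Matrix (Fin N) (Fin N) ℂ))
    {U : CfgY (Matrix (Fin N) (Fin N) ℂ) i} {c₀ α₀ : ℝ} (hc : c₀ ≤ 10) (hMα : 0 ≤ (kGeo i).M * α₀)
    (hreg : (bg9KP (Matrix (Fin N) (Fin N) ℂ) G i).Reg335 c₀ α₀ U) {α₀' : ℝ} (hα' : 0 < α₀') (hα3 : C0 (d + 1) * α₀' ≤ 1 / 3)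
    (hα2 : 2 * α₀' ≤ c2' (d + 1) (ℓ + 1)) (hK : Kpl i ((kGeo i).M * α₀) * (kGeo i).L ^ 4 < α₀')
    {M₂ : ℝ} (hM₂ : 0 ≤ M₂) (hrepr : ∀ (v : Matrix (Fin N) (Fin N) ℂ) (j : ι), |b.repr v j| ≤ M₂ * ‖v‖)
    (d₁ d₂ d₃ d₄ : ℕ) {δ αst α' α C C₄ As Ak θE K : ℝ} (hAs : 0 ≤ As) (hAk : 0 ≤ Ak) (hθE : 0 ≤ θE) (hK0 : 0 ≤ K) (hC : 0 ≤ C) (hC1 : 1 ≤ C) (hC₄ : 0 ≤ C₄)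
    (hαδ : 0 ≤ αst * δ) (hα'0 : 0 ≤ α') (hα'1 : α' ≤ 1) (hδ' : 0 ≤ (1 - αst) * δ)
    (hαδ₂ : 0 ≤ αst * ((1 - α') * ((1 - αst) * δ))) (hδ'₂ : 0 ≤ (1 - αst) * ((1 - α') * ((1 - αst) * δ)))
    (hαδ₃ : 0 ≤ αst * ((1 - α') * ((1 - αst) * ((1 - α') * ((1 - αst) * δ)))))
    (hδ'₃ : 0 ≤ (1 - αst) * ((1 - α') * ((1 - αst) * ((1 - α') * ((1 - αst) * δ)))))
    (hαδ₄ : 0 ≤ (1 - α) * ((1 - α') * ((1 - αst) * ((1 - α') * ((1 - αst) * ((1 - α') * ((1 - αst) * δ)))))))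
    (htri : Triangle254 (toB6 (geo9K i) Rr Hp)) (hrefl : ∀ y : (geo9K i).Site, (geo9K i).dist y y = 0)
    (hdnn : ∀ a a' : (geo9K i).Site, 0 ≤ (geo9K i).dist a a')
    (hST : ScaleTransfer (geo9K i) δ αst C (fun a => (geo9K i).len a ^ 2))
    (h261 : Ineq261 d₁ (toB6 (geo9K i) Rr Hp) ((1 - αst) * δ) α')
    (hST₂ : ScaleTransfer (geo9K i) ((1 - α') * ((1 - αst) * δ)) αst C (fun a => (geo9K i).len a ^ 2))
    (h261₂ : Ineq261 d₂ (toB6 (geo9K i) Rr Hp) ((1 - αst) * ((1 - α') * ((1 - αst) * δ))) α')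
    (hST₃ : ScaleTransfer (geo9K i) ((1 - α') * ((1 - αst) * ((1 - α') * ((1 - αst) * δ)))) αst C₄ (fun a => ((geo9K i).len a ^ 4)⁻¹))
    (h261₃ : Ineq261 d₃ (toB6 (geo9K i) Rr Hp) ((1 - αst) * ((1 - α') * ((1 - αst) * ((1 - α') * ((1 - αst) * δ))))) α')
    (h261₄ : Ineq261 d₄ (toB6 (geo9K i) Rr Hp) ((1 - α') * ((1 - αst) * ((1 - α') * ((1 - αst) * ((1 - α') * ((1 - αst) * δ)))))) α)
    (h263₄ : Ineq263 d₄ (toB6 (geo9K i) Rr Hp) ((1 - α') * ((1 - αst) * ((1 - α') * ((1 - αst) * ((1 - α') * ((1 - αst) * δ)))))) α)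
    (hsmall : ((2 * (8 * ((d : ℝ) + 1) ^ 2 * α₀') * (M₂ * ∑ j, ‖b j‖)) * (M₂ * ∑ j, ‖b j‖) * (As * As * C * B6.c1 d₁ ((1 - αst) * δ) α') +
          (M₂ * ∑ j, ‖b j‖) * (M₂ * ∑ j, ‖b j‖) *
            ((As + Ak) * (Ak * (θE * As) * C * B6.c1 d₁ ((1 - αst) * δ) α') * C * B6.c1 d₂ ((1 - αst) * ((1 - α') * ((1 - αst) * δ))) α') +
          (M₂ * ∑ j, ‖b j‖) * ((2 * (8 * ((d : ℝ) + 1) ^ 2 * α₀') * (M₂ * ∑ j, ‖b j‖))) * (Ak * Ak * C * B6.c1 d₁ ((1 - αst) * δ) α')) * K * C₄ *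
        B6.c1 d₃ ((1 - αst) * ((1 - α') * ((1 - αst) * ((1 - α') * ((1 - αst) * δ))))) α' *
        B6.c1 d₄ ((1 - α') * ((1 - αst) * ((1 - α') * ((1 - αst) * ((1 - α') * ((1 - αst) * δ)))))) α < 1)
    (hE : HasMajorant (g := toB6 (geo9K i) Rr Hp) (fun p : SiteY i × ι => ιB (blkOf i.D.toDomains p.1))
      (conj b ((etaS i ^ 2)⁻¹ • (deltaPrimeAY i (parSymY i) U - deltaPrimeAY i (parKnitY i) U).restrictScalars ℝ))
      (fun a a' : (geo9K i).Site => if a = a' then θE * ((geo9K i).len a ^ 2)⁻¹ else 0))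
    (hGs : HasMajorant (g := toB6 (geo9K i) Rr Hp) (fun p : SiteY i × ι => ιB (blkOf i.D.toDomains p.1))
      (conj b ((etaS i ^ 2) • (GpY i (parSymY i) U).restrictScalars ℝ)) (fun a a' => As * (geo9K i).len a ^ 2 * Real.exp (-(δ * (geo9K i).dist a a'))))
    (hGk : HasMajorant (g := toB6 (geo9K i) Rr Hp) (fun p : SiteY i × ι => ιB (blkOf i.D.toDomains p.1))
      (conj b ((etaS i ^ 2) • (GpY i (parKnitY i) U).restrictScalars ℝ)) (fun a a' => Ak * (geo9K i).len a ^ 2 * Real.exp (-(δ * (geo9K i).dist a a'))))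
    (hT₀ : HasMajorant (g := toB6 (geo9K i) Rr Hp) (fun q : BlkY i × ι => ιB q.1)
      (conj b ((etaS i ^ 2 * etaS i ^ 2)⁻¹ • (XinvY i (parSymY i) (GpY i (parSymY i)) U).restrictScalars ℝ))
      (fun a a' => K * ((geo9K i).len a ^ 4)⁻¹ * Real.exp (-(δ * (geo9K i).dist a a')))) :
    HasMajorant (g := toB6 (geo9K i) Rr Hp) (fun q : BlkY i × ι => ιB q.1)
      (conj b ((etaS i ^ 2 * etaS i ^ 2)⁻¹ • (XinvY i (parKnitY i) (GpY i (parKnitY i)) U).restrictScalars ℝ))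
      (fun a a' => K * B6.c1 d₄ ((1 - α') * ((1 - αst) * ((1 - α') * ((1 - αst) * ((1 - α') * ((1 - αst) * δ)))))) α *
          (1 - ((2 * (8 * ((d : ℝ) + 1) ^ 2 * α₀') * (M₂ * ∑ j, ‖b j‖)) * (M₂ * ∑ j, ‖b j‖) * (As * As * C * B6.c1 d₁ ((1 - αst) * δ) α') +
              (M₂ * ∑ j, ‖b j‖) * (M₂ * ∑ j, ‖b j‖) *
                ((As + Ak) * (Ak * (θE * As) * C * B6.c1 d₁ ((1 - αst) * δ) α') * C * B6.c1 d₂ ((1 - αst) * ((1 - α') * ((1 - αst) * δ))) α') +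
              (M₂ * ∑ j, ‖b j‖) * ((2 * (8 * ((d : ℝ) + 1) ^ 2 * α₀') * (M₂ * ∑ j, ‖b j‖))) * (Ak * Ak * C * B6.c1 d₁ ((1 - αst) * δ) α')) * K * C₄ *
            B6.c1 d₃ ((1 - αst) * ((1 - α') * ((1 - αst) * ((1 - α') * ((1 - αst) * δ))))) α' *
            B6.c1 d₄ ((1 - α') * ((1 - αst) * ((1 - α') * ((1 - αst) * ((1 - α') * ((1 - αst) * δ)))))) α)⁻¹ *
        ((geo9K i).len a ^ 4)⁻¹ *
        Real.exp (-((1 - α) * ((1 - α') * ((1 - αst) * ((1 - α') * ((1 - αst) * ((1 - α') * ((1 - αst) * δ)))))) * (geo9K i).dist a a'))) := by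
  have hU : ∀ μ x, U μ x ∈ G := fun μ x => mem_of_reg335P (G := G) i hreg μ x
  have hUu : ∀ μ x, U μ x ∈ unitaryUnits (Matrix (Fin N) (Fin N) ℂ) := fun μ x => hGU (hU μ x)
  have hparK : ∀ z w : SiteY i, parKnitY i U z w ∈ unitaryUnits (Matrix (Fin N) (Fin N) ℂ) :=
    fun z w => parKnitY_mem_unitary_of_reg335P i hG1 hGU U hc hMα hreg hα' hα3 hα2 hK z w
  have hSb : 0 ≤ ∑ j, ‖b j‖ := Finset.sum_nonneg fun _ _ => norm_nonneg _
  have hc₁ := c1_nonneg d₁ ((1 - αst) * δ) α'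
  have hc₂ := c1_nonneg d₂ ((1 - αst) * ((1 - α') * ((1 - αst) * δ))) α'
  have hθF : 0 ≤ (2 * (8 * ((d : ℝ) + 1) ^ 2 * α₀') * (M₂ * ∑ j, ‖b j‖)) * (M₂ * ∑ j, ‖b j‖) * (As * As * C * B6.c1 d₁ ((1 - αst) * δ) α') +
      (M₂ * ∑ j, ‖b j‖) * (M₂ * ∑ j, ‖b j‖) *
        ((As + Ak) * (Ak * (θE * As) * C * B6.c1 d₁ ((1 - αst) * δ) α') * C * B6.c1 d₂ ((1 - αst) * ((1 - α') * ((1 - αst) * δ))) α') +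
      (M₂ * ∑ j, ‖b j‖) * ((2 * (8 * ((d : ℝ) + 1) ^ 2 * α₀') * (M₂ * ∑ j, ‖b j‖))) * (Ak * Ak * C * B6.c1 d₁ ((1 - αst) * δ) α') := by positivity
  -- file 23b: the `F`-majorant at the rate `δ″`
  have hF := hasMajorant_conj_XY_sym_sub_knit_reg335 i b ιB (Rr := Rr) (Hp := Hp) hG1 hGU hc hMα hreg hα' hα3 hα2 hK hM₂ hrepr d₁ d₂ hAs hAk hθE hC hC1 hαδ
    hα'0 hα'1 hδ' hαδ₂ hδ'₂ htri hdnn hST h261 hST₂ h261₂ hE hGs hGk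
  -- FILE 10's `T₀` weakened to the rate `δ″` (`δ″ ≤ δ′ ≤ δ`)
  have hw₂ : ∀ a : (geo9K i).Site, 0 ≤ ((geo9K i).len a ^ 4)⁻¹ := fun a => inv_nonneg.2 (pow_nonneg (geo9K_len_pos i a).le 4)
  have hle : (1 - α') * ((1 - αst) * ((1 - α') * ((1 - αst) * δ))) ≤ δ := (rate_le hαδ₂ hα'0 hδ'₂).trans (rate_le hαδ hα'0 hδ')
  have hT₀' := hasMajorant_rate_mono i (Rr := Rr) (Hp := Hp) (fun q : BlkY i × ι => ιB q.1) (fun a => ((geo9K i).len a ^ 4)⁻¹) hK0 hw₂ hle hT₀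
  exact hasMajorant_conj_XinvY_parKnitY_of_parSymY i b ιB le_rfl hUu hparK d₃ d₄ hθF hK0 hC₄ hαδ₃ hα'0 hα'1 hδ'₃ hαδ₄ htri hrefl hdnn hST₃ h261₃ h261₄ h263₄
    hsmall hF hT₀'


end Cinv

end Literature.MathematicalPhysics.QuantumFieldTheory.Balaban1983to89.B9B8KnitLetterXDiffCinvReg335

end
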